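import Literature.AlgebraicGeometry.Resolution.LogRegularRefinementRegular
import HarnessLib

/-!
# Completion sandwiches with coefficients through `Â → Ŝ` (Kato 1994, (3.2)/(10.3); Matsumura §8)

`Literature/AlgebraicGeometry/Resolution/LogRegularCompletionSandwich.lean`. Support for removing
the completeness hypothesis in Kato's refinement theorem (K. Kato, *Toric singularities*,
Amer. J. Math. 116 (1994), (10.3), proved from the structure theorem (3.2) for `𝒪̂`): the
uniqueness principle for ring maps out of the completion `Â` of a Noetherian local ring
(density of `A` modulo `𝔪̂ⁿ`, Matsumura §8), and two variants of the completion sandwich of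
`LogRegularRefinement.lean` in which the coefficient ring `Λ` maps into the completion `Ŝ`
(through `Â → Ŝ` for a base `A → S`) rather than into `S`.

* `exists_sub_algebraMap_mem_pow`, `ringHom_ext_adicCompletion`;
* `ringKrullDim_le_of_completion_sandwich'` (coefficients `Λ → Ŝ`);
* `ringKrullDim_le_of_sandwich_over_base` (coefficients `Λ → Â → Ŝ`, maps `ρ̂ : Â → R′`,
  `ρ_S : S → R′` agreeing on `A`).

References: [Kato1994] K. Kato, Toric singularities, Amer. J. Math. 116 (1994), (3.2), (10.3);
[Matsumura1987] H. Matsumura, Commutative Ring Theory, §8 and Thm. 8.4.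
-/

noncomputable section

open IsLocalRing MvPowerSeries Literature.RingTheory.MvPowerSeries
  Literature.RingTheory.MvPowerSeries.monoidPowerSeries
  Literature.RingTheory.CompleteLocalRings

namespace Literature.AlgebraicGeometry.Resolution

namespace LogRegularCompleteStructure

universe u v

/-! ### Density of `A` in `Â` and uniqueness of extensions -/

section Density

variable {A : Type u} [CommRing A] [IsLocalRing A] [IsNoetherianRing A]

/-- **Density**: every element of `Â` is congruent to an element of `A` modulo `𝔪_Â ^ n`.
[cite: Matsumura1987, §8] -/
theorem exists_sub_algebraMap_mem_pow (x : AdicCompletion (maximalIdeal A) A) (n : ℕ) :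
    ∃ a : A, x - algebraMap A _ a ∈ maximalIdeal (AdicCompletion (maximalIdeal A) A) ^ n := by
  obtain ⟨a, ha⟩ := Ideal.Quotient.mk_surjective (AdicCompletion.evalₐ (maximalIdeal A) n x)
  refine ⟨a, ?_⟩
  have h0 : AdicCompletion.eval (maximalIdeal A) A n (x - algebraMap A _ a) = 0 := by
    have h1 : AdicCompletion.evalₐ (maximalIdeal A) n (x - algebraMap A _ a) = 0 := by
      rw [map_sub, AdicCompletion.algebraMap_apply, Algebra.algebraMap_self, RingHom.id_apply,
        AdicCompletion.evalₐ_of, ha, sub_self]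
    have h2 := AdicCompletion.factor_evalₐ_eq_eval (I := maximalIdeal A) (x - algebraMap A _ a)
      (n := n) (by intro y hy; simpa using hy)
    rw [h1, map_zero] at h2
    exact h2.symm
  rw [AdicCompletion.maximalIdeal_eq_map, ← Ideal.map_pow, ← Submodule.restrictScalars_mem A,
    ← Ideal.smul_top_eq_map,
    AdicCompletion.pow_smul_top_eq_ker_eval (maximalIdeal A).fg_of_isNoetherianRing]
  exact h0

/-- **Uniqueness of extensions to the completion**: two ring homomorphisms `Â → R` into a
Noetherian local ring which send `𝔪_Â` into `𝔪_R` and agree on `A` are equal (the difference of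
the values at `x ≡ a mod 𝔪_Âⁿ` lies in `𝔪_Rⁿ` for every `n`). [cite: Matsumura1987, §8] -/
theorem ringHom_ext_adicCompletion {R : Type v} [CommRing R] [IsLocalRing R] [IsNoetherianRing R]
    (f g : AdicCompletion (maximalIdeal A) A →+* R)
    (hf : (maximalIdeal (AdicCompletion (maximalIdeal A) A)).map f ≤ maximalIdeal R)
    (hg : (maximalIdeal (AdicCompletion (maximalIdeal A) A)).map g ≤ maximalIdeal R)
    (h : ∀ a : A, f (algebraMap A _ a) = g (algebraMap A _ a)) : f = g := by
  refine RingHom.ext fun x => ?_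
  rw [← sub_eq_zero, ← Ideal.mem_bot,
    ← Ideal.iInf_pow_eq_bot_of_isLocalRing (maximalIdeal R) (maximalIdeal.isMaximal R).ne_top,
    Ideal.mem_iInf]
  intro n
  obtain ⟨a, ha⟩ := exists_sub_algebraMap_mem_pow x n
  have hf' := Ideal.mem_map_of_mem f ha
  have hg' := Ideal.mem_map_of_mem g ha
  rw [Ideal.map_pow] at hf' hg'
  have hf'' := Ideal.pow_right_mono hf n hf'
  have hg'' := Ideal.pow_right_mono hg n hg'
  rw [map_sub, h a] at hf''
  rw [map_sub] at hg''
  have := Ideal.sub_mem _ hf'' hg''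
  rwa [sub_sub_sub_cancel_right] at this

end Density

/-! ### The completion sandwich with coefficients in `Ŝ` -/

/-- **Completion sandwich, coefficients `Λ → Ŝ`.** As `ringKrullDim_le_of_completion_sandwich`,
but the coefficient ring maps into the completion `Ŝ` (not into `S`), and the compatibility of
`q` with the constants is stated in `R̂′`: `dim R′ ≤ dim S`. [cite: Kato1994, (10.3)]
[cite: Matsumura1987, Thm. 8.4] -/
theorem ringKrullDim_le_of_completion_sandwich' {Λ : Type u} [CommRing Λ] [IsLocalRing Λ]
    [IsAdicComplete (maximalIdeal Λ) Λ]
    {S : Type u} [CommRing S] [IsLocalRing S] [IsNoetherianRing S]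
    {R' : Type u} [CommRing R'] [IsLocalRing R'] [IsNoetherianRing R']
    [IsAdicComplete (maximalIdeal R') R'] {N : ℕ}
    (jT : Λ →+* AdicCompletion (maximalIdeal S) S) [IsLocalHom jT]
    (hresT : ∀ y, ∃ l : Λ, y - jT l ∈ maximalIdeal (AdicCompletion (maximalIdeal S) S))
    (x : Fin N → S) (hx : maximalIdeal S = Ideal.span (Set.range x))
    (ρ : S →+* R') (hρ : (maximalIdeal S).map ρ ≤ maximalIdeal R')
    (q : MvPowerSeries (Fin N) Λ →+* R') (hq : Function.Surjective q)
    (hqX : ∀ i, q (MvPowerSeries.X i) = ρ (x i))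
    (hqC : ∀ l, algebraMap R' (AdicCompletion (maximalIdeal R') R') (q (MvPowerSeries.C l)) =
      adicCompletionMap (maximalIdeal S) (maximalIdeal R') ρ hρ (jT l)) :
    ringKrullDim R' ≤ ringKrullDim S := by
  classical
  rw [← ringKrullDim_adicCompletion S]
  haveI : IsNoetherianRing (AdicCompletion (maximalIdeal S) S) :=
    isNoetherianRing_adicCompletion_maximalIdeal S
  let β : AdicCompletion (maximalIdeal S) S →+* R' :=
    (AdicCompletion.ofAlgEquiv (maximalIdeal R')).symm.toRingHom.comp
      (adicCompletionMap (maximalIdeal S) (maximalIdeal R') ρ hρ)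
  have hβof : ∀ s, β (algebraMap S (AdicCompletion (maximalIdeal S) S) s) = ρ s := by
    intro s
    show (AdicCompletion.ofAlgEquiv _).symm
      (adicCompletionMap _ _ ρ hρ (AdicCompletion.of _ _ s)) = _
    rw [adicCompletionMap_of, AdicCompletion.ofAlgEquiv_symm_of]
  have hβjT : ∀ l, β (jT l) = q (MvPowerSeries.C l) := by
    intro l
    show (AdicCompletion.ofAlgEquiv _).symm (adicCompletionMap _ _ ρ hρ (jT l)) = _
    rw [← hqC, AdicCompletion.algebraMap_apply, Algebra.algebraMap_self, RingHom.id_apply,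
      AdicCompletion.ofAlgEquiv_symm_of]
  have hofmem : ∀ s ∈ maximalIdeal S, algebraMap S (AdicCompletion (maximalIdeal S) S) s ∈
      maximalIdeal (AdicCompletion (maximalIdeal S) S) := by
    intro s hs
    rw [AdicCompletion.maximalIdeal_eq_map]
    exact Ideal.mem_map_of_mem _ hs
  let xT : Fin N → AdicCompletion (maximalIdeal S) S := fun i =>
    algebraMap S (AdicCompletion (maximalIdeal S) S) (x i)
  have hxTm : ∀ i, xT i ∈ maximalIdeal _ := fun i =>
    hofmem _ (hx ▸ Ideal.subset_span ⟨i, rfl⟩)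
  have hgenT : maximalIdeal (AdicCompletion (maximalIdeal S) S) ≤
      Ideal.span (Set.range xT) ⊔ (maximalIdeal Λ).map jT := by
    refine le_trans (le_of_eq ?_) le_sup_left
    rw [AdicCompletion.maximalIdeal_eq_map]
    have h1 := congrArg (Ideal.map (algebraMap S (AdicCompletion (maximalIdeal S) S))) hx
    rw [h1, Ideal.map_span, ← Set.range_comp]
    rfl
  obtain ⟨α, hαX, hαC, hαsurj⟩ :=
    exists_mvPowerSeries_ringHom_surjective_of_base jT hresT xT hxTm hgenT
  have hβα : β.comp α = q := by
    refine ringHom_ext_mvPowerSeries _ _ (fun i => ?_) (fun i => ?_) (fun l => ?_)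
    · rw [RingHom.comp_apply, hαX, hqX]
      exact hβof (x i)
    · rw [RingHom.comp_apply, hαX]
      show β (algebraMap S _ (x i)) ∈ _
      rw [hβof]
      exact hρ (Ideal.mem_map_of_mem _ (hx ▸ Ideal.subset_span ⟨i, rfl⟩))
    · rw [RingHom.comp_apply, hαC, hβjT]
  have hβsurj : Function.Surjective β := by
    intro r
    obtain ⟨F, rfl⟩ := hq r
    exact ⟨α F, by rw [← RingHom.comp_apply, hβα]⟩
  exact ringKrullDim_le_of_surjective β hβsurj

/-! ### The sandwich over a base `A`: coefficients through `Â → Ŝ` -/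

set_option maxHeartbeats 400000 in
/-- **Completion sandwich over a base.** `A → S` a local map of Noetherian local rings inducing a
surjection on residue fields, `Λ → Â` Cohen coefficients of `Â`, `x₁,…,x_N` generators of `𝔪_S`,
`ρ̂ : Â → R′`, `ρ_S : S → R′` local maps into a complete Noetherian local ring agreeing on `A`,
and a surjection `q : Λ⟦T⟧ → R′` with `q(Tᵢ) = ρ_S(xᵢ)`, `q(l) = ρ̂(l)`. Then `dim R′ ≤ dim S`.
[cite: Kato1994, (10.3)] [cite: Matsumura1987, Thm. 8.4] -/
theorem ringKrullDim_le_of_sandwich_over_base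
    {A : Type u} [CommRing A] [IsLocalRing A] [IsNoetherianRing A]
    {Λ : Type u} [CommRing Λ] [IsLocalRing Λ] [IsAdicComplete (maximalIdeal Λ) Λ]
    {S : Type u} [CommRing S] [IsLocalRing S] [IsNoetherianRing S]
    {R' : Type u} [CommRing R'] [IsLocalRing R'] [IsNoetherianRing R']
    [IsAdicComplete (maximalIdeal R') R'] {N : ℕ}
    (j : Λ →+* AdicCompletion (maximalIdeal A) A) [IsLocalHom j]
    (hres : ∀ a : AdicCompletion (maximalIdeal A) A, ∃ l : Λ,
      a - j l ∈ maximalIdeal (AdicCompletion (maximalIdeal A) A))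
    (aS : A →+* S) (haSm : (maximalIdeal A).map aS ≤ maximalIdeal S)
    (hresS : ∀ s : S, ∃ a : A, s - aS a ∈ maximalIdeal S)
    (x : Fin N → S) (hx : maximalIdeal S = Ideal.span (Set.range x))
    (ρh : AdicCompletion (maximalIdeal A) A →+* R')
    (hρh : (maximalIdeal (AdicCompletion (maximalIdeal A) A)).map ρh ≤ maximalIdeal R')
    (ρS : S →+* R') (hρS : (maximalIdeal S).map ρS ≤ maximalIdeal R')
    (hcomp : ρS.comp aS = ρh.comp (algebraMap A (AdicCompletion (maximalIdeal A) A)))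
    (q : MvPowerSeries (Fin N) Λ →+* R') (hq : Function.Surjective q)
    (hqX : ∀ i, q (MvPowerSeries.X i) = ρS (x i)) (hqC : ∀ l, q (MvPowerSeries.C l) = ρh (j l)) :
    ringKrullDim R' ≤ ringKrullDim S := by
  classical
  haveI : IsNoetherianRing (AdicCompletion (maximalIdeal S) S) :=
    isNoetherianRing_adicCompletion_maximalIdeal S
  haveI : IsNoetherianRing (AdicCompletion (maximalIdeal R') R') :=
    isNoetherianRing_adicCompletion_maximalIdeal R'
  have hofA : ∀ a, algebraMap A (AdicCompletion (maximalIdeal A) A) a =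
      AdicCompletion.of (maximalIdeal A) A a := fun a => rfl
  -- `Â → Ŝ`
  let ιh : AdicCompletion (maximalIdeal A) A →+* AdicCompletion (maximalIdeal S) S :=
    adicCompletionMap (maximalIdeal A) (maximalIdeal S) aS haSm
  have hιh_of : ∀ a : A, ιh (algebraMap A _ a) = algebraMap S _ (aS a) := fun a =>
    adicCompletionMap_of _ _ aS haSm a
  have hιh_max : (maximalIdeal (AdicCompletion (maximalIdeal A) A)).map ιh ≤ maximalIdeal _ := by
    rw [AdicCompletion.maximalIdeal_eq_map, Ideal.map_map, Ideal.map_le_iff_le_comap]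
    intro a ha
    rw [Ideal.mem_comap, RingHom.comp_apply, hιh_of, AdicCompletion.maximalIdeal_eq_map]
    exact Ideal.mem_map_of_mem _ (haSm (Ideal.mem_map_of_mem _ ha))
  let jT : Λ →+* AdicCompletion (maximalIdeal S) S := ιh.comp j
  haveI : IsLocalHom jT := by
    refine ⟨fun l hl => ?_⟩
    by_contra hln
    have h1 : j l ∈ maximalIdeal _ := (mem_maximalIdeal _).2 (mem_nonunits_iff.2
      fun hu => hln (isUnit_of_map_unit j l hu))
    have h2 := hιh_max (Ideal.mem_map_of_mem ιh h1)
    exact ((mem_maximalIdeal _).1 h2) hl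
  have hresT : ∀ y, ∃ l : Λ, y - jT l ∈ maximalIdeal (AdicCompletion (maximalIdeal S) S) := by
    intro y
    obtain ⟨s, hs⟩ := exists_sub_algebraMap_mem_maximalIdeal_adicCompletion (A := S) y
    obtain ⟨a, ha⟩ := hresS s
    obtain ⟨l, hl⟩ := hres (algebraMap A _ a)
    refine ⟨l, ?_⟩
    have h2 : algebraMap S (AdicCompletion (maximalIdeal S) S) s - ιh (algebraMap A _ a) ∈
        maximalIdeal _ := by
      rw [hιh_of, ← map_sub, AdicCompletion.maximalIdeal_eq_map]
      exact Ideal.mem_map_of_mem _ ha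
    have h3 : ιh (algebraMap A _ a) - jT l ∈ maximalIdeal _ := by
      show ιh _ - ιh (j l) ∈ _
      rw [← map_sub]
      exact hιh_max (Ideal.mem_map_of_mem _ hl)
    have := Ideal.add_mem _ (Ideal.add_mem _ hs h2) h3
    rwa [sub_add_sub_cancel, sub_add_sub_cancel] at this
  refine ringKrullDim_le_of_completion_sandwich' jT hresT x hx ρS hρS q hq hqX (fun l => ?_)
  -- compatibility on constants: two ring maps `Â → R̂'` agreeing on `A`
  rw [hqC]
  show _ = adicCompletionMap _ _ ρS hρS (ιh (j l))
  rw [adicCompletionMap_comp]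
  have hof_max : (maximalIdeal R').map (algebraMap R' (AdicCompletion (maximalIdeal R') R')) ≤
      maximalIdeal _ := by
    rw [AdicCompletion.maximalIdeal_eq_map]
  have key := ringHom_ext_adicCompletion
    ((algebraMap R' (AdicCompletion (maximalIdeal R') R')).comp ρh)
    (adicCompletionMap (maximalIdeal A) (maximalIdeal R') (ρS.comp aS)
      (by rw [← Ideal.map_map]; exact le_trans (Ideal.map_mono haSm) hρS))
    (by rw [← Ideal.map_map]; exact le_trans (Ideal.map_mono hρh) hof_max)
    (by
      rw [Ideal.map_le_iff_le_comap, AdicCompletion.maximalIdeal_eq_map, Ideal.map_le_iff_le_comap]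
      intro a ha
      rw [Ideal.mem_comap, Ideal.mem_comap, hofA, adicCompletionMap_of,
        AdicCompletion.maximalIdeal_eq_map]
      exact Ideal.mem_map_of_mem _ (hρS (Ideal.mem_map_of_mem _ (haSm (Ideal.mem_map_of_mem _ ha)))))
    (fun a => by
      show algebraMap R' _ (ρh (algebraMap A _ a)) =
        adicCompletionMap _ _ (ρS.comp aS) _ (algebraMap A _ a)
      rw [hofA a, adicCompletionMap_of, hcomp]
      rfl)
  exact RingHom.congr_fun key (j l)


end LogRegularCompleteStructure

end Literature.AlgebraicGeometry.Resolution
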